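import Summits.PneNP.PneNP.Theorems.ConvexRankGatesCaptureCyclicFredholm
import Summits.PneNP.PneNP.Theorems.ConvexRankGatesCaptureBaerCoset
import HarnessLib

/-!
# Crux `Capture` (stmt-PneNP-2659), line `csp-spine-meet-to-join` rev 5–6 — the landed bundle

The registered stub `stub_landedAwaitingBuild` of the skeleton `Cruxes/Capture/Lines/csp_spine_meet_to_join.lean` is the
conjunction of two theorems landed earlier on the line: Stub 2 `stub_cyclicFredholm` (LIN gates are poly-size
`permBasis` circuits; `ConvexRankGatesCaptureCyclicFredholm.lean`) and the Baer corollary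
`isAbelianCosetGate_of_odd_central` (coset gates over odd-order class-2 groups are abelian coset gates;
`ConvexRankGatesCaptureBaerCoset.lean`). This file only pairs them, so that the skeleton can import one built module.
Continuation lead c2, 2026-08-16. [folklore]
-/

namespace Summit.PneNP.PneNP.Cruxes.Capture.CspSpineMeetToJoin

set_option linter.dupNamespace false -- `Summit.PneNP.PneNP.…`: summit = sub-problem (D-0017)

open scoped commutatorElement
open Literature.Computability.Complexity

/-- **Stub 0 — the landed bundle** (registered stub of skeleton rev 5/6 of line `csp-spine-meet-to-join`):
`CyclicFredholmLanded ∧ BaerLanded`, i.e. the landed `stub_cyclicFredholm` paired with the landed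
`isAbelianCosetGate_of_odd_central`. [folklore] -/
theorem stub_landedAwaitingBuild :
    (∃ c : ℕ, ∀ (s : ℕ) (g : GateFn), IsLinGate s g →
      ∃ C : Circuit (Fin g.1), C.IsOver (permBasis ((s + 2) ^ c)) ∧ C.size ≤ (s + 2) ^ c ∧
        C.Computes g.2) ∧
    (∀ (s : ℕ) (g : GateFn), (g.1 ≤ s ∧ ∃ (G : Type) (_ : Group G) (_ : Fintype G) (nv : ℕ),
      Odd (Fintype.card G) ∧ (∀ x y z : G, ⁅x, y⁆ * z = z * ⁅x, y⁆) ∧ Fintype.card G ≤ s ∧ nv ≤ s ∧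
      ∃ (r : Fin g.1 → ℕ) (scope : (j : Fin g.1) → Fin (r j) → Fin nv)
        (H : (j : Fin g.1) → Subgroup (Fin (r j) → G)) (c : (j : Fin g.1) → Fin (r j) → G),
        (∀ j, Fintype.card G ^ r j ≤ s) ∧
        ∀ v : Fin g.1 → Bool, g.2 v = true ↔
          ¬ ∃ h : Fin nv → G, ∀ j, v j = true → (c j)⁻¹ * (fun i => h (scope j i)) ∈ H j) →
      IsAbelianCosetGate s g) :=
  ⟨stub_cyclicFredholm, isAbelianCosetGate_of_odd_central⟩

end Summit.PneNP.PneNP.Cruxes.Capture.CspSpineMeetToJoin
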